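import Literature.NumberTheory.Automorphic.UnitaryThreeEigenlineNormalForm          -- (d3) PART 1 (B-p12): Witt for the unit norm class, block form in `H`
import Literature.NumberTheory.Automorphic.UnitaryThreeRamifiedTorusMars            -- ★ γ2′ (B-p12): `v_sq_sub_mul_sq_eq_max` (exponent link)
import HarnessLib

/-!
# The κ = +1 normal form, step 2: inside `H`, a type-(2) element is `H`-conjugate to the ramified torus literal `!![A,0,Cρ; 0,u,0; C,0,A]`, `|ρ| = |ϖ|`
(Flicker (1998), *Elementary proof of the fundamental lemma for a unitary group*, Prop. 3 p. 78: `T_H = {δ⁻¹(β, πα∕√D; α√D, β)} × E¹ ⊂ H`; Prop. 6 p. 83; proof of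
Theorem 18 p. 97: `α = Bπ^N`, `n = min(1+2N, 2+2N₂)`)

Topic `NumberTheory/Automorphic`; namespace `Literature.NumberTheory.Automorphic.UnitaryGroup`.  THEOREMS ONLY (no `def`, no instance, no notation, no named fact,
no `sorry`).  Cell `pub/hodgecm-mathlib`, crux H413 = `stmt-HodgeConjecture-24833`, road «N7-ns COUNT FROM FLICKER» (architect A-p06 (g26)), line «N7nsCount»,
value stub `stub_irredGValuePos` (κ = +1): brick **(d3) «κ = +1 FRAME STEP»** (LEAD F0P3a-plan (g9) T8-118), PART 2 of 2.  OUTPUT = the hypotheses of ★ A-p03 (g24)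
p841959 `natCard_fixedPoints_unitaryInt_ramifiedTorus_eq_phiTHM_final` (`hte : ↑↑t′ = !![A,0,B;0,b₀,0;C,0,A]`, `hBC : B = Cρ`, `hvρ : |ρ| = |ϖ|`, `hσρ`) for a
`U`-CONJUGATE `t′ = g⁻¹tg` of the given `t`, together with the EXPONENT LINK to the observable invariants of `t` (`tr t = 2A + u`, `det t = u(A² − C²ρ)`, whence
`(tr t − u)² − 4 det t∕u = 4C²ρ` and `χ₂(u) = (u − A)² − C²ρ`, read by ★ `v_sq_sub_mul_sq_eq_max`: `v(χ₂(u)) = min(2·ord(u − A), 1 + 2·ord C)` = `min(2N₊, 2N+1)`).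
HONEST LABEL: HC_CM is proved only modulo the printed citations (2 remaining named inputs hLiu418, h413) until rung 0 closes; structure theory, pays nothing by itself.

THE MATHEMATICS.  By PART 1, `t₁ = g₁⁻¹tg₁ = !![α,0,β;0,u,0;γ,0,δ]`.  TYPE (2) means the corner's discriminant `(α+δ)² − 4(αδ−βγ)` has ODD valuation; then `γ ≠ 0`.  With
`b := (α − δ)∕(2γ)` one has `σb = −b` (★ γ0: `σα·Δ = α`, `σδ·Δ = δ`, `σγ·Δ = −γ`), so the unipotent `n_b = !![1,0,b;0,1,0;0,0,1] ∈ H` and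
`n_b⁻¹ t₁ n_b = !![A,0,β₂; 0,u,0; γ,0,A]`, `A = (α+δ)∕2`, `β₂ = disc∕(4γ)`; `ρ₂ = β₂∕γ` has odd valuation `2r+1`.  Finally `diag(κ,1,κ⁻¹)` (`κ = ϖ^j`) scales `ρ` by
`κ⁻⁴` and the antidiagonal `(0,X;X⁻¹,0) ⊕ 1` (`X = ϖ^m`) replaces `ρ` by `X⁴∕ρ`; one of them (by the parity of `r`) reaches `|ρ| = |ϖ|`.  `σρ = ρ` for every unitary block
`(A, Cρ; C, A)` (★ γ0: `σ(Cρ)·Δ = −Cρ`, `σC·Δ = −C`).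

## References
* [Flicker1998UnitaryFL] Y. Z. Flicker, Canad. J. Math. 50 (1998), Prop. 3 p. 78, Prop. 6 p. 83, Theorem 18 p. 97.
* [Rogawski1990] J. D. Rogawski, Ann. of Math. Stud. 123 (1990), §3.6 (stable classes of elliptic tori in `U(2)`), §4.9 p. 55.
-/

set_option autoImplicit false

noncomputable section

open scoped MatrixGroups WithZero Valued
open Matrix

namespace Literature.NumberTheory.Automorphic

namespace UnitaryGroup

open Literature.NumberTheory.Automorphic.HermitianLattice

variable {K : Type*} [Field K] [Valued K ℤᵐ⁰] {ϖ : K}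
  (σ : K →+* K) {J : Matrix (Fin 3) (Fin 3) K} (hJ : J = (StdForm.antidiagonal 3).over K)

/-! ## §1 Algebra of the three conjugations inside `H` -/

omit [Valued K ℤᵐ⁰] in
include hJ in
/-- **The unipotent `n_b = !![1,0,b;0,1,0;0,0,1] ∈ U`** for `σb = −b`, with inverse `n_{−b}`. [cite: Flicker1998UnitaryFL, Prop. 6 p. 83] -/
theorem exists_coe_eq_unipotentBlock {b : K} (hb : σ b = -b) :
    ∃ n : ↥(unitaryGroupOfForm σ J), (((n : ↥(unitaryGroupOfForm σ J)) : GL (Fin 3) K) : Matrix (Fin 3) (Fin 3) K) = !![1, 0, b; 0, 1, 0; 0, 0, 1] ∧ (((n⁻¹ : ↥(unitaryGroupOfForm σ J)) : GL (Fin 3) K) : Matrix (Fin 3) (Fin 3) K) = !![1, 0, -b; 0, 1, 0; 0, 0, 1] := by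
  obtain ⟨n, hn⟩ := exists_coe_eq_block_of_rel σ hJ (α := 1) (β := b) (γ := 0) (δ := 1) (e := 1)
    (by rw [map_one, map_zero]; ring) (by rw [map_one, map_zero]; ring) (by rw [hb, map_one]; ring) (by rw [hb, map_one]; ring)
    (by rw [map_one, mul_one])
  refine ⟨n, hn, ?_⟩
  rw [Subgroup.coe_inv, Matrix.coe_units_inv, hn]
  refine Matrix.inv_eq_left_inv ?_
  rw [block_mul_block]
  ext i j
  fin_cases i <;> fin_cases j <;> simp

omit [Valued K ℤᵐ⁰] in
include hJ in
/-- **The antidiagonal `w_X = !![0,0,X;0,1,0;X⁻¹,0,0] ∈ U`** for `σX = X ≠ 0`; `w_X⁻¹ = w_X`. [cite: Flicker1998UnitaryFL, Prop. 6 p. 83] -/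
theorem exists_coe_eq_antidiagBlock {X : K} (hX : σ X = X) (hX0 : X ≠ 0) :
    ∃ w : ↥(unitaryGroupOfForm σ J), (((w : ↥(unitaryGroupOfForm σ J)) : GL (Fin 3) K) : Matrix (Fin 3) (Fin 3) K) = !![0, 0, X; 0, 1, 0; X⁻¹, 0, 0] ∧ (((w⁻¹ : ↥(unitaryGroupOfForm σ J)) : GL (Fin 3) K) : Matrix (Fin 3) (Fin 3) K) = !![0, 0, X; 0, 1, 0; X⁻¹, 0, 0] := by
  obtain ⟨w, hw⟩ := exists_coe_eq_block_of_rel σ hJ (α := 0) (β := X) (γ := X⁻¹) (δ := 0) (e := 1)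
    (by rw [map_zero]; ring) (by rw [map_zero, map_inv₀, hX, zero_mul, zero_add, inv_mul_cancel₀ hX0])
    (by rw [map_zero, hX, zero_mul, add_zero, mul_inv_cancel₀ hX0]) (by rw [map_zero]; ring) (by rw [map_one, mul_one])
  refine ⟨w, hw, ?_⟩
  rw [Subgroup.coe_inv, Matrix.coe_units_inv, hw]
  refine Matrix.inv_eq_left_inv ?_
  rw [block_mul_block]
  ext i j
  fin_cases i <;> fin_cases j <;> simp [hX0]

omit [Valued K ℤᵐ⁰] in
include hJ in
/-- **The torus `d_κ = diag(κ, 1, κ⁻¹) ∈ U`** for `σκ = κ ≠ 0`, with inverse `d_{κ⁻¹}`. [cite: Flicker1998UnitaryFL, Prop. 4 p. 80] -/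
theorem exists_coe_eq_fixedTorusDiag (hσ : ∀ a, σ (σ a) = a) {κ : K} (hκ : σ κ = κ) (hκ0 : κ ≠ 0) :
    ∃ e : ↥(unitaryGroupOfForm σ J), (((e : ↥(unitaryGroupOfForm σ J)) : GL (Fin 3) K) : Matrix (Fin 3) (Fin 3) K) = !![κ, 0, 0; 0, 1, 0; 0, 0, κ⁻¹] ∧ (((e⁻¹ : ↥(unitaryGroupOfForm σ J)) : GL (Fin 3) K) : Matrix (Fin 3) (Fin 3) K) = !![κ⁻¹, 0, 0; 0, 1, 0; 0, 0, κ] := by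
  obtain ⟨e, he⟩ := exists_coe_eq_torusDiag σ hJ hσ hκ0
  rw [hκ] at he
  refine ⟨e, he, ?_⟩
  rw [Subgroup.coe_inv, Matrix.coe_units_inv, he]
  refine Matrix.inv_eq_left_inv ?_
  rw [block_mul_block]
  ext i j
  fin_cases i <;> fin_cases j <;> simp [hκ0]

omit [Valued K ℤᵐ⁰] in
include hJ in
/-- `σ(B∕C) = B∕C` for a unitary block `!![A,0,B;0,e,0;C,0,A′]` with `C ≠ 0` (★ γ0: `σB·Δ = −B`, `σC·Δ = −C`). [cite: Flicker1998UnitaryFL, Prop. 6 p. 83] -/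
theorem map_div_eq_of_coe_eq_block {h : ↥(unitaryGroupOfForm σ J)} {A B C A' e : K} (hh : (((h : ↥(unitaryGroupOfForm σ J)) : GL (Fin 3) K) : Matrix (Fin 3) (Fin 3) K) = !![A, 0, B; 0, e, 0; C, 0, A']) (hC : C ≠ 0) :
    σ (B / C) = B / C := by
  have hh3 : ((h : GL (Fin 3) K)) ∈ unitaryGroupOfForm σ ((StdForm.antidiagonal 3).over K) := by rw [← hJ]; exact h.2
  obtain ⟨⟨R1, R2, R3, R4⟩, -⟩ := SplitDictionary.rel_of_coe_eq_block σ hh3 hh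
  have hΔ := SplitDictionary.det_ne_zero σ R1 R2
  have hb := SplitDictionary.map_b_mul_det σ R3 R4
  have hc := SplitDictionary.map_c_mul_det σ R1 R2
  have eσB : σ B = -B / (A * A' - B * C) := by rw [eq_div_iff hΔ]; exact hb
  have eσC : σ C = -C / (A * A' - B * C) := by rw [eq_div_iff hΔ]; exact hc
  rw [map_div₀, eσB, eσC]; field_simp

/-! ## §2 The normal form -/

include hJ in
/-- **THE κ = +1 FRAME STEP (type (2))**: let `t ∈ U(σ, Φ₃)` have an eigenvector `x`, `t x = u x`, with `B₀(x,x)` of EVEN valuation (the `κ = +1` class), and let the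
complementary quadratic factor have discriminant of ODD valuation: `v((tr t − u)² − 4·det t∕u) = exp(2m+1)` (torus of type (2), `T ≃ (EL)¹ × E¹`).  Then for some `g ∈ U`:
**`g⁻¹ t g = !![A, 0, Cρ; 0, u, 0; C, 0, A]`** with `C ≠ 0`, **`|ρ| = |ϖ|`**, `σρ = ρ`, `σu·u = 1`, and the EXPONENT LINK `tr t = 2A + u`, `det t = u·(A² − C²ρ)` — the literal
and hypotheses of ★ `natCard_fixedPoints_unitaryInt_ramifiedTorus_eq_phiTHM_final` (A-p03) ∕ ★ γ2′, at a conjugate of `t`.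
[cite: Flicker1998UnitaryFL, Prop. 3 p. 78; Prop. 6 p. 83; Theorem 18 p. 97] -/
theorem exists_conj_coe_eq_ramifiedTorus (hd : LocalConjDatum σ ϖ) (hσO : ∀ y : 𝒪[K], (σ.comp 𝒪[K].subtype) y ∈ 𝒪[K])
    [IsDiscreteValuationRing 𝒪[K]] [Finite (IsLocalRing.ResidueField 𝒪[K])] [IsAdicComplete 𝓂[K] 𝒪[K]]
    {a₀ : 𝒪[K]} (ha₀ : IsUnit (((σ.comp 𝒪[K].subtype).codRestrict 𝒪[K] hσO) a₀ - a₀))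
    {t : ↥(unitaryGroupOfForm σ J)} {x : Fin 3 → K} {u : K} (htx : (((t : ↥(unitaryGroupOfForm σ J)) : GL (Fin 3) K) : Matrix (Fin 3) (Fin 3) K) *ᵥ x = u • x) {k : ℤ} (hx : Valued.v (B₀ σ 3 x x) = WithZero.exp (2 * k))
    {m : ℤ} (hdisc : Valued.v ((Matrix.trace (((t : ↥(unitaryGroupOfForm σ J)) : GL (Fin 3) K) : Matrix (Fin 3) (Fin 3) K) - u) ^ 2 - 4 * (Matrix.det (((t : ↥(unitaryGroupOfForm σ J)) : GL (Fin 3) K) : Matrix (Fin 3) (Fin 3) K) / u)) = WithZero.exp (2 * m + 1)) :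
    ∃ g : ↥(unitaryGroupOfForm σ J), ∃ A C ρ : K, (((g⁻¹ * t * g : ↥(unitaryGroupOfForm σ J)) : GL (Fin 3) K) : Matrix (Fin 3) (Fin 3) K) = !![A, 0, C * ρ; 0, u, 0; C, 0, A] ∧ C ≠ 0 ∧ Valued.v ρ = Valued.v ϖ ∧ σ ρ = ρ ∧ σ u * u = 1 ∧
      Matrix.trace (((t : ↥(unitaryGroupOfForm σ J)) : GL (Fin 3) K) : Matrix (Fin 3) (Fin 3) K) = 2 * A + u ∧ Matrix.det (((t : ↥(unitaryGroupOfForm σ J)) : GL (Fin 3) K) : Matrix (Fin 3) (Fin 3) K) = u * (A ^ 2 - C ^ 2 * ρ) := by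
  have hσ := hd.σσ
  have hϖ0 : ϖ ≠ 0 := hd.ϖ_ne_zero
  have hvϖ := hd.vϖ
  have hσϖ := hd.σϖ
  have h20 : (2 : K) ≠ 0 := fun h0 => by have := hd.v2; rw [h0, map_zero] at this; exact zero_ne_one this
  have h40 : (4 : K) ≠ 0 := by rw [show (4 : K) = 2 * 2 by norm_num]; exact mul_ne_zero h20 h20
  have hv4 : Valued.v (4 : K) = 1 := by rw [show (4 : K) = 2 * 2 by norm_num, map_mul, hd.v2, one_mul]
  have hmat : ∀ a c : ↥(unitaryGroupOfForm σ J), (((a * c : ↥(unitaryGroupOfForm σ J)) : GL (Fin 3) K) : Matrix (Fin 3) (Fin 3) K) = (((a : ↥(unitaryGroupOfForm σ J)) : GL (Fin 3) K) : Matrix (Fin 3) (Fin 3) K) * (((c : ↥(unitaryGroupOfForm σ J)) : GL (Fin 3) K) : Matrix (Fin 3) (Fin 3) K) := fun a c => by rw [Subgroup.coe_mul, Units.val_mul]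
  -- PART 1: into `H`
  obtain ⟨g₁, α, β, γ, δ, hM₁, hu⟩ := exists_conj_coe_eq_block_of_eigen σ hJ hd hσO ha₀ htx hx
  have hu0 : u ≠ 0 := fun h0 => by rw [h0, mul_zero] at hu; exact zero_ne_one hu
  -- trace and determinant through the conjugation
  have htr : Matrix.trace (((t : ↥(unitaryGroupOfForm σ J)) : GL (Fin 3) K) : Matrix (Fin 3) (Fin 3) K) = α + u + δ := by
    have h1 : Matrix.trace (((g₁⁻¹ * t * g₁ : ↥(unitaryGroupOfForm σ J)) : GL (Fin 3) K) : Matrix (Fin 3) (Fin 3) K) = Matrix.trace (((t : ↥(unitaryGroupOfForm σ J)) : GL (Fin 3) K) : Matrix (Fin 3) (Fin 3) K) := by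
      rw [hmat, hmat, Subgroup.coe_inv]; exact Matrix.trace_units_conj' _ _
    rw [← h1, hM₁, Matrix.trace_fin_three]; simp
  have hdet : Matrix.det (((t : ↥(unitaryGroupOfForm σ J)) : GL (Fin 3) K) : Matrix (Fin 3) (Fin 3) K) = u * (α * δ - β * γ) := by
    have h1 : Matrix.det (((g₁⁻¹ * t * g₁ : ↥(unitaryGroupOfForm σ J)) : GL (Fin 3) K) : Matrix (Fin 3) (Fin 3) K) = Matrix.det (((t : ↥(unitaryGroupOfForm σ J)) : GL (Fin 3) K) : Matrix (Fin 3) (Fin 3) K) := by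
      rw [hmat, hmat, Subgroup.coe_inv]; exact Matrix.det_units_conj' _ _
    rw [← h1, hM₁, Matrix.det_fin_three]; simp; ring
  have hT : Matrix.trace (((t : ↥(unitaryGroupOfForm σ J)) : GL (Fin 3) K) : Matrix (Fin 3) (Fin 3) K) - u = α + δ := by rw [htr]; ring
  have hD : Matrix.det (((t : ↥(unitaryGroupOfForm σ J)) : GL (Fin 3) K) : Matrix (Fin 3) (Fin 3) K) / u = α * δ - β * γ := by rw [hdet]; field_simp
  rw [hT, hD] at hdisc
  -- the corner relations
  have ht₁3 : (((g₁⁻¹ * t * g₁ : ↥(unitaryGroupOfForm σ J))) : GL (Fin 3) K) ∈ unitaryGroupOfForm σ ((StdForm.antidiagonal 3).over K) := by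
    rw [← hJ]; exact (g₁⁻¹ * t * g₁).2
  obtain ⟨⟨R1, R2, R3, R4⟩, -⟩ := SplitDictionary.rel_of_coe_eq_block σ ht₁3 hM₁
  have hΔ0 := SplitDictionary.det_ne_zero σ R1 R2
  have eσα : σ α = α / (α * δ - β * γ) := by rw [eq_div_iff hΔ0]; exact SplitDictionary.map_a_mul_det σ R1 R2
  have eσδ : σ δ = δ / (α * δ - β * γ) := by rw [eq_div_iff hΔ0]; exact SplitDictionary.map_d_mul_det σ R3 R4
  have eσγ : σ γ = -γ / (α * δ - β * γ) := by rw [eq_div_iff hΔ0]; exact SplitDictionary.map_c_mul_det σ R1 R2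
  -- `γ ≠ 0` (type (2))
  have hdisc0 : (α + δ) ^ 2 - 4 * (α * δ - β * γ) ≠ 0 := fun h0 => by
    rw [h0, map_zero] at hdisc; exact WithZero.coe_ne_zero hdisc.symm
  have hγ0 : γ ≠ 0 := by
    intro h0
    have e1 : (α + δ) ^ 2 - 4 * (α * δ - β * γ) = (α - δ) ^ 2 := by rw [h0]; ring
    rw [e1, map_pow] at hdisc
    have hαδ : Valued.v (α - δ) ≠ 0 := fun h1 => by rw [h1, zero_pow two_ne_zero] at hdisc; exact WithZero.coe_ne_zero hdisc.symm
    rw [← WithZero.exp_log hαδ, ← WithZero.exp_nsmul, nsmul_eq_mul] at hdisc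
    have := WithZero.exp_injective hdisc
    push_cast at this
    omega
  have hvγ0 : Valued.v γ ≠ 0 := (Valuation.ne_zero_iff _).2 hγ0
  obtain ⟨lg, hlg⟩ : ∃ lg : ℤ, Valued.v γ = WithZero.exp lg := ⟨_, (WithZero.exp_log hvγ0).symm⟩
  -- the unipotent `n_b`, `b = (α − δ)∕(2γ)`
  set b : K := (α - δ) / (2 * γ) with hbdef
  have hσb : σ b = -b := by
    rw [hbdef, map_div₀, map_sub, map_mul, map_ofNat, eσα, eσδ, eσγ]; field_simp
  obtain ⟨n, hn, hninv⟩ := exists_coe_eq_unipotentBlock σ hJ hσb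
  set A : K := (α + δ) / 2 with hAdef
  set β₂ : K := ((α + δ) ^ 2 - 4 * (α * δ - β * γ)) / (4 * γ) with hβ₂def
  have hβ₂0 : β₂ ≠ 0 := div_ne_zero hdisc0 (mul_ne_zero h40 hγ0)
  have hM₂ : (((n⁻¹ * (g₁⁻¹ * t * g₁) * n : ↥(unitaryGroupOfForm σ J)) : GL (Fin 3) K) : Matrix (Fin 3) (Fin 3) K) = !![A, 0, β₂; 0, u, 0; γ, 0, A] := by
    rw [hmat, hmat, hninv, hn, hM₁, block_mul_block, block_mul_block]
    ext i l
    fin_cases i <;> fin_cases l <;> simp [hAdef, hβ₂def, hbdef] <;> field_simp <;> ring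
  have hvρ₂ : Valued.v (β₂ / γ) = WithZero.exp (2 * (m - lg) + 1) := by
    rw [map_div₀, hβ₂def, map_div₀, hdisc, map_mul, hv4, one_mul, hlg, ← WithZero.exp_sub, ← WithZero.exp_sub]
    congr 1; ring
  -- the group identity for the triple conjugation
  have hconj : ∀ e : ↥(unitaryGroupOfForm σ J), (g₁ * n * e)⁻¹ * t * (g₁ * n * e) = e⁻¹ * (n⁻¹ * (g₁⁻¹ * t * g₁) * n) * e := fun e => by group
  -- parity of `r = m − lg`
  obtain ⟨s, hs | hs⟩ := Int.even_or_odd' (m - lg)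
  · -- `r = 2s`: the antidiagonal `w_X`, `X = ϖ^{−s}`: `ρ = X⁴γ∕β₂`
    set X : K := ϖ ^ (-s) with hXdef
    have hX0 : X ≠ 0 := zpow_ne_zero _ hϖ0
    have hσX : σ X = X := by rw [hXdef, map_zpow₀, hσϖ]
    have hvX : Valued.v X = WithZero.exp s := by rw [hXdef, map_zpow₀, hvϖ, ← WithZero.exp_zsmul, smul_eq_mul]; congr 1; ring
    obtain ⟨w, hw, hwinv⟩ := exists_coe_eq_antidiagBlock σ hJ hσX hX0
    have hM₃ : (((w⁻¹ * (n⁻¹ * (g₁⁻¹ * t * g₁) * n) * w : ↥(unitaryGroupOfForm σ J)) : GL (Fin 3) K) : Matrix (Fin 3) (Fin 3) K) = !![A, 0, (β₂ / X ^ 2) * (X ^ 4 * γ / β₂); 0, u, 0; β₂ / X ^ 2, 0, A] := by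
      rw [hmat, hmat, hwinv, hw, hM₂, block_mul_block, block_mul_block]
      ext i l
      fin_cases i <;> fin_cases l <;> simp <;> field_simp
    refine ⟨g₁ * n * w, A, β₂ / X ^ 2, X ^ 4 * γ / β₂, ?_, div_ne_zero hβ₂0 (pow_ne_zero _ hX0), ?_, ?_, hu, ?_, ?_⟩
    · rw [hconj, hM₃]
    · have e1 : X ^ 4 * γ / β₂ = X ^ 4 / (β₂ / γ) := by field_simp
      rw [e1, map_div₀, map_pow, hvX, hvρ₂, hvϖ, ← WithZero.exp_nsmul, ← WithZero.exp_sub, nsmul_eq_mul]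
      congr 1; push_cast; omega
    · have e1 : X ^ 4 * γ / β₂ = ((β₂ / X ^ 2) * (X ^ 4 * γ / β₂)) / (β₂ / X ^ 2) := by field_simp
      rw [e1]
      exact map_div_eq_of_coe_eq_block σ hJ hM₃ (div_ne_zero hβ₂0 (pow_ne_zero _ hX0))
    · rw [htr, hAdef]; field_simp; ring
    · rw [hdet, hAdef, hβ₂def]; field_simp; ring
  · -- `r = 2s+1`: the torus `d_κ`, `κ = ϖ^{−(s+1)}`: `ρ = β₂∕(κ⁴γ)`
    set κ : K := ϖ ^ (-(s + 1)) with hκdef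
    have hκ0 : κ ≠ 0 := zpow_ne_zero _ hϖ0
    have hσκ : σ κ = κ := by rw [hκdef, map_zpow₀, hσϖ]
    have hvκ : Valued.v κ = WithZero.exp (s + 1) := by rw [hκdef, map_zpow₀, hvϖ, ← WithZero.exp_zsmul, smul_eq_mul]; congr 1; ring
    obtain ⟨e, he, heinv⟩ := exists_coe_eq_fixedTorusDiag σ hJ hσ hσκ hκ0
    have hM₃ : (((e⁻¹ * (n⁻¹ * (g₁⁻¹ * t * g₁) * n) * e : ↥(unitaryGroupOfForm σ J)) : GL (Fin 3) K) : Matrix (Fin 3) (Fin 3) K) = !![A, 0, (κ ^ 2 * γ) * (β₂ / (κ ^ 4 * γ)); 0, u, 0; κ ^ 2 * γ, 0, A] := by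
      rw [hmat, hmat, heinv, he, hM₂, block_mul_block, block_mul_block]
      ext i l
      fin_cases i <;> fin_cases l <;> simp <;> field_simp
    refine ⟨g₁ * n * e, A, κ ^ 2 * γ, β₂ / (κ ^ 4 * γ), ?_, mul_ne_zero (pow_ne_zero _ hκ0) hγ0, ?_, ?_, hu, ?_, ?_⟩
    · rw [hconj, hM₃]
    · have e1 : β₂ / (κ ^ 4 * γ) = (β₂ / γ) / κ ^ 4 := by field_simp
      rw [e1, map_div₀, map_pow, hvκ, hvρ₂, hvϖ, ← WithZero.exp_nsmul, ← WithZero.exp_sub, nsmul_eq_mul]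
      congr 1; push_cast; omega
    · have e1 : β₂ / (κ ^ 4 * γ) = ((κ ^ 2 * γ) * (β₂ / (κ ^ 4 * γ))) / (κ ^ 2 * γ) := by field_simp
      rw [e1]
      exact map_div_eq_of_coe_eq_block σ hJ hM₃ (mul_ne_zero (pow_ne_zero _ hκ0) hγ0)
    · rw [htr, hAdef]; field_simp; ring
    · rw [hdet, hAdef, hβ₂def]; field_simp; ring

/-- **THE EXPONENT LINK, valuations**: for the literal of `exists_conj_coe_eq_ramifiedTorus` (`|ρ| = |ϖ|`): `v((tr t − u)² − 4 det t∕u) = |ϖ|·|C|²` and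
`v(u² − (tr t − u)u + det t∕u) = max(|u − A|², |ϖ|·|C|²)` — so `2N+1 = 1 + 2·ord C` and `n = min(2·ord(u − A), 2N+1)` for the stub's `(n, N)` (★ `v_sq_sub_mul_sq_eq_max`).
[cite: Flicker1998UnitaryFL, Theorem 18 p. 97] -/
theorem v_disc_and_v_eval_of_ramifiedTorus (hd : LocalConjDatum σ ϖ) {T D u A C ρ : K} (hu0 : u ≠ 0) (hvρ : Valued.v ρ = Valued.v ϖ)
    (htr : T = 2 * A + u) (hdet : D = u * (A ^ 2 - C ^ 2 * ρ)) :
    Valued.v ((T - u) ^ 2 - 4 * (D / u)) = Valued.v ϖ * Valued.v C ^ 2 ∧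
      Valued.v (u ^ 2 - (T - u) * u + D / u) = max (Valued.v (u - A) ^ 2) (Valued.v ϖ * Valued.v C ^ 2) := by
  have hvπ : Valued.v ρ = WithZero.exp (-1 : ℤ) := by rw [hvρ, hd.vϖ]
  have hv4 : Valued.v (4 : K) = 1 := by rw [show (4 : K) = 2 * 2 by norm_num, map_mul, hd.v2, one_mul]
  constructor
  · have e1 : (T - u) ^ 2 - 4 * (D / u) = 4 * (C ^ 2 * ρ) := by rw [htr, hdet]; field_simp; ring
    rw [e1, map_mul, hv4, one_mul, map_mul, map_pow, hvρ, mul_comm]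
  · have e1 : u ^ 2 - (T - u) * u + D / u = (u - A) ^ 2 - ρ * C ^ 2 := by rw [htr, hdet]; field_simp; ring
    rw [e1, v_sq_sub_mul_sq_eq_max hvπ, hd.vϖ]

end UnitaryGroup

end Literature.NumberTheory.Automorphic

end
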